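import Summits.HodgeConjecture.HodgeConjecture.Theorems.Ring2WeilCoverageCMFieldSexticIntegerRows
import Summits.HodgeConjecture.HodgeConjecture.Theorems.Ring2WeilCoverageCMFieldCompositeSexticCarrierSqrtNegThree
import Summits.HodgeConjecture.HodgeConjecture.Theorems.Ring2WeilCoverageCMFieldNonGaloisSexticCarrier
import HarnessLib

/-!
# Ring 2 — Weil-type family-coverage census, CM-field rows (X-AJ): the INTEGER rows of the last two sextic tables —
# `ℚ(ζ₇)⁺(√−3)` (`R₂₁ = S³ + 15S² + 54S + 27`) and the non-Galois `F₁₄₈(i)` (`R₁₄₈ = S³ + 7S² + 11S + 1`)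

HONEST FRAMING: research route conditional on HC_CM; not a corollary; Q11.4-sentence-2 already refuted in dim ≥ 3.

Cell `pub-hodge-ring2`, seat `ring2-b03` (gen 60), census `HOME/WEIL-FAMILY-COVERAGE.md` «## b03» (b03.23–b03.25). Part X-AI's
generic integer classification for odd-degree carriers containing `ℚ(√−3)` / `ℚ(i)` (`natCast_eq_split_iff_of_neg_three`,
`natCast_eq_split_iff_of_neg_one` and the row structures) instantiated on the two remaining sextic census carriers with
their `t` of parts X-AF / X-AG, stated on the LITERAL carriers (`sextic_census_fields_integer_classification_B`,
`sextic_census_fields_integer_rows_B`): `ℚ(ζ₇)⁺(√−3)` — **`[n] = [1] ⟺ every prime `ℓ ≡ 2 (mod 3)` divides `n` to an even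
power**; `F₁₄₈(i)` — **`⟺ every prime `ℓ ≡ 3 (mod 4)` divides `n` to an even power** (`n ≥ 1`), and `[n₁] = [n₂] ⟺` equal
exponent parities at those primes. With X-AI, the integer rows `W12.E.[n]` of ALL SIX sextic census tables of b03.23 are decided in closed form.

THEOREMS ONLY: no `def`, no named fact, no `sorry`; `HC_CM` does not occur; nothing about the Hodge conjecture is asserted.
References: [Deligne1982HodgeCycles] §4 display (1) and Cor. 4.2 (a) — p. 28 of the Milne re-edition (the series' earlier «§4 p. 30 (1)» tag mixes editions: lit-reduction P-lit-127-2, applied here); [Landherr1936HermitianForms]; [Cox2013] §1 (1.1). -/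

noncomputable section

set_option linter.dupNamespace false

open Polynomial

namespace Summit.HodgeConjecture.HodgeConjecture.Ring2.WeilCoverageCM

open Literature.AlgebraicGeometry.Deligne1982
open Literature.AlgebraicGeometry.HodgeTheory (splitDiscriminantClassCM)

/-! ### The two carriers, literally (no per-carrier `hR`-hypothesis copies of X-AI's statements: the dedup lint identifies
them with the `ℚ(ζ₉)` / `ℚ(ζ₇)⁺(i)` instances; the literal packagings below are the new content) -/

/-- **The integer rows of `W12.ℚ(ζ₇)⁺(√−3)` and `W12.F₁₄₈(i)`, unconditionally** (literal carriers
`R₂₁ = S³ + 15S² + 54S + 27`, `R₁₄₈ = S³ + 7S² + 11S + 1`; field instances from parts X-AF / X-AG; `t` with `σt² = −3`, resp.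
`−1`, from `R21_root_mul_sq_eq_neg_three` / `R148_root_mul_sq_eq_neg_one`; X-AI's generic `natCast_eq_split_iff_of_neg_three` /
`…_of_neg_one`): for every `n ≥ 1` and every unit `v = n` of `F`: `ℚ(ζ₇)⁺(√−3)` — `[n] = [(−1)²] ⟺` every prime `ℓ ≡ 2 (mod 3)`
divides `n` to an even power (table b03.23: `[7] = [21] = [1]`; `[2], [5], [11] ≠ [1]`); `F₁₄₈(i)` — `⟺` every prime `ℓ ≡ 3 (mod 4)`
divides `n` to an even power. [cite: Deligne1982HodgeCycles, §4 (1) p. 28 and Cor. 4.2 (a) (Milne re-edition)] [cite: Landherr1936HermitianForms] -/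
theorem sextic_census_fields_integer_classification_B (n : ℕ) (hn : 1 ≤ n) :
    (haveI := R21_fact_realPolyQ
     haveI := R21_fact_cmPolyQ
     ∀ v : (realField (X ^ 3 + C 15 * X ^ 2 + C 54 * X + C 27 : Polynomial ℤ))ˣ,
      (v : realField (X ^ 3 + C 15 * X ^ 2 + C 54 * X + C 27 : Polynomial ℤ)) = n →
      ((QuotientGroup.mk v : cmNormResidueGroup (X ^ 3 + C 15 * X ^ 2 + C 54 * X + C 27 : Polynomial ℤ)) =
          splitDiscriminantClassCM (X ^ 3 + C 15 * X ^ 2 + C 54 * X + C 27 : Polynomial ℤ) 2 ↔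
        ∀ ℓ : ℕ, ℓ.Prime → ℓ % 3 = 2 → Even (n.factorization ℓ))) ∧
    (haveI := R148_fact_realPolyQ
     haveI := R148_fact_cmPolyQ
     ∀ v : (realField (X ^ 3 + C 7 * X ^ 2 + C 11 * X + C 1 : Polynomial ℤ))ˣ,
      (v : realField (X ^ 3 + C 7 * X ^ 2 + C 11 * X + C 1 : Polynomial ℤ)) = n →
      ((QuotientGroup.mk v : cmNormResidueGroup (X ^ 3 + C 7 * X ^ 2 + C 11 * X + C 1 : Polynomial ℤ)) =
          splitDiscriminantClassCM (X ^ 3 + C 7 * X ^ 2 + C 11 * X + C 1 : Polynomial ℤ) 2 ↔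
        ∀ ℓ : ℕ, ℓ.Prime → ℓ % 4 = 3 → Even (n.factorization ℓ))) := by
  refine ⟨?_, ?_⟩
  · haveI := R21_fact_realPolyQ
    haveI := R21_fact_cmPolyQ
    intro v hv
    have hodd : Odd (X ^ 3 + C 15 * X ^ 2 + C 54 * X + C 27 : Polynomial ℤ).natDegree := by
      rw [(monic_and_natDegree_of_cubic (X ^ 3 + C 15 * X ^ 2 + C 54 * X + C 27 : Polynomial ℤ) rfl).2]; exact ⟨1, rfl⟩
    exact natCast_eq_split_iff_of_neg_three hodd _ (R21_root_mul_sq_eq_neg_three rfl) n hn v hv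
  · haveI := R148_fact_realPolyQ
    haveI := R148_fact_cmPolyQ
    intro v hv
    have hodd : Odd (X ^ 3 + C 7 * X ^ 2 + C 11 * X + C 1 : Polynomial ℤ).natDegree := by
      rw [(monic_and_natDegree_of_cubic (X ^ 3 + C 7 * X ^ 2 + C 11 * X + C 1 : Polynomial ℤ) rfl).2]; exact ⟨1, rfl⟩
    exact natCast_eq_split_iff_of_neg_one hodd _ (R148_root_mul_sq_eq_neg_one rfl) n hn v hv

/-- **The row structure of the integer classes of `W12.ℚ(ζ₇)⁺(√−3)` and `W12.F₁₄₈(i)`, unconditionally**: for `n₁, n₂ ≥ 1`,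
`[n₁] = [n₂] ⟺` every prime `ℓ ≡ 2 (mod 3)` (resp. `ℓ ≡ 3 (mod 4)`) occurs in `n₁`, `n₂` with exponents of the same parity
(X-AI's generic `natCast_mk_eq_mk_iff_of_neg_three` / `…_of_neg_one`).
[cite: Deligne1982HodgeCycles, §4 (1) p. 28 and Cor. 4.2 (a) (Milne re-edition)] [cite: Landherr1936HermitianForms] -/
theorem sextic_census_fields_integer_rows_B {n₁ n₂ : ℕ} (hn₁ : 1 ≤ n₁) (hn₂ : 1 ≤ n₂) :
    (haveI := R21_fact_realPolyQ
     haveI := R21_fact_cmPolyQ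
     ∀ u v : (realField (X ^ 3 + C 15 * X ^ 2 + C 54 * X + C 27 : Polynomial ℤ))ˣ,
      (u : realField (X ^ 3 + C 15 * X ^ 2 + C 54 * X + C 27 : Polynomial ℤ)) = n₁ →
      (v : realField (X ^ 3 + C 15 * X ^ 2 + C 54 * X + C 27 : Polynomial ℤ)) = n₂ →
      ((QuotientGroup.mk u : cmNormResidueGroup (X ^ 3 + C 15 * X ^ 2 + C 54 * X + C 27 : Polynomial ℤ)) =
          QuotientGroup.mk v ↔
        ∀ ℓ : ℕ, ℓ.Prime → ℓ % 3 = 2 → (Even (n₁.factorization ℓ) ↔ Even (n₂.factorization ℓ)))) ∧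
    (haveI := R148_fact_realPolyQ
     haveI := R148_fact_cmPolyQ
     ∀ u v : (realField (X ^ 3 + C 7 * X ^ 2 + C 11 * X + C 1 : Polynomial ℤ))ˣ,
      (u : realField (X ^ 3 + C 7 * X ^ 2 + C 11 * X + C 1 : Polynomial ℤ)) = n₁ →
      (v : realField (X ^ 3 + C 7 * X ^ 2 + C 11 * X + C 1 : Polynomial ℤ)) = n₂ →
      ((QuotientGroup.mk u : cmNormResidueGroup (X ^ 3 + C 7 * X ^ 2 + C 11 * X + C 1 : Polynomial ℤ)) =
          QuotientGroup.mk v ↔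
        ∀ ℓ : ℕ, ℓ.Prime → ℓ % 4 = 3 → (Even (n₁.factorization ℓ) ↔ Even (n₂.factorization ℓ)))) := by
  refine ⟨?_, ?_⟩
  · haveI := R21_fact_realPolyQ
    haveI := R21_fact_cmPolyQ
    intro u v hu hv
    have hodd : Odd (X ^ 3 + C 15 * X ^ 2 + C 54 * X + C 27 : Polynomial ℤ).natDegree := by
      rw [(monic_and_natDegree_of_cubic (X ^ 3 + C 15 * X ^ 2 + C 54 * X + C 27 : Polynomial ℤ) rfl).2]; exact ⟨1, rfl⟩
    exact natCast_mk_eq_mk_iff_of_neg_three hodd _ (R21_root_mul_sq_eq_neg_three rfl) hn₁ hn₂ u v hu hv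
  · haveI := R148_fact_realPolyQ
    haveI := R148_fact_cmPolyQ
    intro u v hu hv
    have hodd : Odd (X ^ 3 + C 7 * X ^ 2 + C 11 * X + C 1 : Polynomial ℤ).natDegree := by
      rw [(monic_and_natDegree_of_cubic (X ^ 3 + C 7 * X ^ 2 + C 11 * X + C 1 : Polynomial ℤ) rfl).2]; exact ⟨1, rfl⟩
    exact natCast_mk_eq_mk_iff_of_neg_one hodd _ (R148_root_mul_sq_eq_neg_one rfl) hn₁ hn₂ u v hu hv

end Summit.HodgeConjecture.HodgeConjecture.Ring2.WeilCoverageCM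

end
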